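import Literature.Geometry.Riemannian.ExpMapSecondVariation
import Literature.Geometry.Riemannian.ExpMapLiftAlgebra
import Literature.Geometry.Riemannian.ExpMapGlobalSmooth
import Literature.Geometry.Riemannian.MaximalGeodesicRescaling
import Literature.Geometry.Riemannian.RiemannianDistance
import Literature.Geometry.Lorentzian.MeanCurvatureRegularity
import Mathlib.Analysis.Calculus.Deriv.MeanValue
import Mathlib.MeasureTheory.Integral.IntervalIntegral.FundThmCalculus
import Mathlib.Topology.UniformSpace.HeineCantor
import HarnessLib

/-!
# The energy of the variations `exp_{γ(t)}(σ X(t))`: second-order Taylor bound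
(Lee 2018, Thm. 6.3, Prop. 6.5 and Thm. 10.22/10.26 — the analysis behind the second variation)

Layer 6e of the programme for `Literature.Geometry.Riemannian.lee_expMap_injectivityDomain`
(Lee 2018, Thm. 10.34, part "bijective differential on `ID(p)`", via Thm. 10.26: a geodesic
minimizing past a conjugate point is impossible). Lee proves Thm. 10.26 with the second variation
formula for the LENGTH of a proper normal variation (Thm. 10.22, Cor. 10.23/10.25). This file
prepares the same argument for the ENERGY `E(σ) = ∫ |∂_t x(t, σ)|² dt` of the variations
`x(t, σ) = exp_{γ(t)}(σ X(t))` through geodesics, which avoids normal/unit-speed bookkeeping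
(O'Neill 1983, Ch. 10, Prop. 39 ff. works with energy in the same way), and WITHOUT
differentiating under the integral sign: from the pointwise derivatives
`∂_σ g(T,T) = 2 g(D_t S, T)` and `∂_σ g(D_t S, T) = g(R(S,T)S,T) + |D_t S|²`
(`ExpMapSecondVariation.lean`) one gets a pointwise second-order Taylor bound with a uniform error
(uniform continuity of the second derivative on a compact rectangle), which integrates to

* `integral_energy_le_taylor` — for `σ ∈ [0, δ(ε)]`,
  `∫_a^b |∂_t x|²(σ) ≤ ∫_a^b |γ'|² + σ ∫_a^b 2 g(D_t X, γ') + σ² (∫_a^b [g(R(X,γ')X,γ') + |D_t X|²] + ε (b - a))`,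
  together with the continuity of the index integrand `g(R(X,γ')X,γ') + |D_t X|²`.

Also: the variation is `C^∞` (`contMDiff_uncurry_expMap_smul_field`), its `σ`-curves are geodesics
(`isGeodesic_expMap_smul_of_isGeodesicallyComplete`), the first-variation integrand integrates to
boundary terms along a geodesic (`integral_val_covariantDerivAlong_velocity`, Lee 2018, Thm. 6.3 /
Prop. 6.5: `∫ g(D_t X, γ') = [g(X, γ')]`), arc length as a real integral
(`length_eq_ofReal_integral`) and the Cauchy–Schwarz inequality `(∫ φ)² ≤ (b - a) ∫ φ²`
(`sq_intervalIntegral_le_length_mul_of_continuous`; Lee 2018, Problem 6-23 (b),(c), p. 190: energy versus length,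
`L(γ|[a,b])² ≤ 2(b-a)E(γ|[a,b])` with equality for constant speed). No definitions, no named facts
(D-0026).

## References

* J. M. Lee, *Introduction to Riemannian Manifolds*, 2nd ed. (2018), Thm. 6.3, Problem 6-23,
  Thm. 10.22, Thm. 10.26. [LeeRiemannianManifolds2018]
* B. O'Neill, *Semi-Riemannian geometry* (1983), Ch. 10, §§1–4. [ONeill1983]
-/

noncomputable section

open Bundle Set Filter Function MeasureTheory
open scoped Manifold ContDiff Topology

namespace Literature.Geometry.Riemannian

open Literature.Geometry.Lorentzian
open Literature.Geometry.Lorentzian.PseudoRiemannianMetric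

/-! ### Real-analysis lemmas -/

/-- **Cauchy–Schwarz for a continuous function on an interval**: `(∫_a^b φ)² ≤ (b - a) ∫_a^b φ²`
(expand `0 ≤ ∫_a^b (φ - m)²` with `m` the mean of `φ`); with `φ = |γ'|` this is
`L(γ|[a,b])² ≤ 2(b - a)E(γ|[a,b])` (Lee 2018, Problem 6-23 (b), p. 190). [folklore] -/
theorem sq_intervalIntegral_le_length_mul_of_continuous {φ : ℝ → ℝ} (hφ : Continuous φ) {a b : ℝ} (hab : a ≤ b) :
    (∫ t in a..b, φ t) ^ 2 ≤ (b - a) * ∫ t in a..b, φ t ^ 2 := by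
  rcases hab.eq_or_lt with rfl | hlt
  · simp
  have hba : 0 < b - a := sub_pos.2 hlt
  have h0 : 0 ≤ ∫ t in a..b, (φ t - (∫ t in a..b, φ t) / (b - a)) ^ 2 :=
    intervalIntegral.integral_nonneg hlt.le fun t _ ↦ sq_nonneg _
  have hI1 : IntervalIntegrable (fun t ↦ φ t ^ 2) volume a b := (hφ.pow 2).intervalIntegrable a b
  have hI2 : IntervalIntegrable (fun t ↦ 2 * ((∫ t in a..b, φ t) / (b - a)) * φ t) volume a b :=
    (continuous_const.mul hφ).intervalIntegrable a b
  have hI3 : IntervalIntegrable (fun _ : ℝ ↦ ((∫ t in a..b, φ t) / (b - a)) ^ 2) volume a b :=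
    continuous_const.intervalIntegrable a b
  have hexp : ∫ t in a..b, (φ t - (∫ t in a..b, φ t) / (b - a)) ^ 2 =
      (∫ t in a..b, φ t ^ 2) - 2 * ((∫ t in a..b, φ t) / (b - a)) * (∫ t in a..b, φ t) +
        (b - a) * ((∫ t in a..b, φ t) / (b - a)) ^ 2 := by
    have h1 : (fun t ↦ (φ t - (∫ t in a..b, φ t) / (b - a)) ^ 2) =
        fun t ↦ φ t ^ 2 - 2 * ((∫ t in a..b, φ t) / (b - a)) * φ t +
          ((∫ t in a..b, φ t) / (b - a)) ^ 2 := funext fun t ↦ by ring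
    rw [h1, intervalIntegral.integral_add (hI1.sub hI2) hI3, intervalIntegral.integral_sub hI1 hI2,
      intervalIntegral.integral_const_mul, intervalIntegral.integral_const, smul_eq_mul]
  have key : (b - a) * ((∫ t in a..b, φ t ^ 2) - 2 * ((∫ t in a..b, φ t) / (b - a)) *
      (∫ t in a..b, φ t) + (b - a) * ((∫ t in a..b, φ t) / (b - a)) ^ 2) =
      (b - a) * (∫ t in a..b, φ t ^ 2) - (∫ t in a..b, φ t) ^ 2 := by
    field_simp
    ring
  have h1 : 0 ≤ (b - a) * ∫ t in a..b, (φ t - (∫ t in a..b, φ t) / (b - a)) ^ 2 :=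
    mul_nonneg hba.le h0
  rw [hexp, key] at h1
  linarith

variable {E : Type*} [NormedAddCommGroup E] [NormedSpace ℝ E] {H : Type*} [TopologicalSpace H]
  {I : ModelWithCorners ℝ E H} {M : Type*} [TopologicalSpace M] [ChartedSpace H M]
  [IsManifold I ∞ M] {n : ℕ∞ω} [FiniteDimensional ℝ E]

/-! ### Smooth lifts along a curve -/

omit [FiniteDimensional ℝ E] in
/-- **The tangent lift of a `C^∞` curve is `C^∞`** (a curve is a two-parameter map constant in
the second parameter; `contMDiff_lift_velocity_uncurry_left`). [folklore] -/
theorem contMDiff_lift_velocity_of_contMDiff {γ : ℝ → M} (hγ : ContMDiff 𝓘(ℝ, ℝ) I ∞ γ) :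
    ContMDiff 𝓘(ℝ, ℝ) I.tangent ∞
      (fun t ↦ (TotalSpace.mk' E (γ t) (velocity I γ t) : TangentBundle I M)) := by
  have hx : ContMDiff (𝓘(ℝ, ℝ).prod 𝓘(ℝ, ℝ)) I ∞ (uncurry fun (t : ℝ) (_ : ℝ) ↦ γ t) :=
    hγ.comp contMDiff_fst
  have h := contMDiff_lift_velocity_uncurry_left hx
  have hline : ContMDiff 𝓘(ℝ, ℝ) (𝓘(ℝ, ℝ).prod 𝓘(ℝ, ℝ)) ∞ (fun t : ℝ ↦ ((t, (0 : ℝ)) : ℝ × ℝ)) :=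
    contMDiff_id.prodMk contMDiff_const
  exact h.comp hline

/-- **`D_t X` has a `C^∞` lift if `X` does**, along any curve, for a locally `C^∞` covariant
derivative (the two-parameter lemma `contMDiff_lift_covariantDerivAlong_curry_left` with a dummy
parameter; O'Neill 1983, Ch. 3, Prop. 3.18 / Ch. 4, p. 123). [cite: ONeill1983, Ch. 4, p. 123] -/
theorem contMDiff_lift_covariantDerivAlong_of_lift
    {cov : CovariantDerivative I E (TangentSpace I : M → Type _)} (hcov : cov.IsLocallyContMDiff ∞)
    {γ : ℝ → M} {X : Π t : ℝ, TangentSpace I (γ t)}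
    (hX : ContMDiff 𝓘(ℝ, ℝ) I.tangent ∞ (fun t ↦ (TotalSpace.mk' E (γ t) (X t) : TangentBundle I M))) :
    ContMDiff 𝓘(ℝ, ℝ) I.tangent ∞
      (fun t ↦ (TotalSpace.mk' E (γ t) (covariantDerivAlong cov γ X t) : TangentBundle I M)) := by
  have hγ : ContMDiff 𝓘(ℝ, ℝ) I ∞ γ := fun t ↦ (contMDiffAt_totalSpace.1 (hX t)).1
  have hx : ContMDiff (𝓘(ℝ, ℝ).prod 𝓘(ℝ, ℝ)) I ∞ (uncurry fun (t : ℝ) (_ : ℝ) ↦ γ t) :=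
    hγ.comp contMDiff_fst
  have hZ : ContMDiff (𝓘(ℝ, ℝ).prod 𝓘(ℝ, ℝ)) I.tangent ∞
      (fun q : ℝ × ℝ ↦ (TotalSpace.mk' E (γ q.1) (X q.1) : TangentBundle I M)) := hX.comp contMDiff_fst
  have h := contMDiff_lift_covariantDerivAlong_curry_left (cov := cov) hcov (x := fun t _ ↦ γ t)
    (Z := fun t _ ↦ X t) hx hZ
  have hline : ContMDiff 𝓘(ℝ, ℝ) (𝓘(ℝ, ℝ).prod 𝓘(ℝ, ℝ)) ∞ (fun t : ℝ ↦ ((t, (0 : ℝ)) : ℝ × ℝ)) :=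
    contMDiff_id.prodMk contMDiff_const
  exact h.comp hline

/-! ### The variations `x(t, σ) = exp_{γ(t)}(σ X(t))` -/

section Variation

variable {cov : CovariantDerivative I E (TangentSpace I : M → Type _)}
  [CompleteSpace E] [T2Space M] [BoundarylessManifold I M]
  [CovariantDerivative.ContMDiffCovariantDerivative cov 1]
  [CovariantDerivative.ContMDiffCovariantDerivative cov ∞]

/-- **The variation `(t, σ) ↦ exp_{γ(t)}(σ X(t))` is `C^∞`** for a `C^∞` lift `t ↦ (γ t, X t)`
and a geodesically complete `C^∞` connection: `(t, σ) ↦ (γ t, σ X t) ∈ TM` is `C^∞`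
(`contMDiff_liftAlong_smul`) and `exp` is `C^∞` on `TM` (`contMDiffOn_expMap_totalSpace`).
Lee 2018, Prop. 5.19 and p. 301 (the variation `Γ(s, t) = exp_{γ(t)}(s V(t))` used for the
variation formulas, Lemma 6.2 / proof of Thm. 10.22). [cite: LeeRiemannianManifolds2018, Prop. 5.19] -/
theorem contMDiff_uncurry_expMap_smul_field (hc : IsGeodesicallyComplete cov)
    {γ : ℝ → M} {X : Π t : ℝ, TangentSpace I (γ t)}
    (hX : ContMDiff 𝓘(ℝ, ℝ) I.tangent ∞ (fun t ↦ (TotalSpace.mk' E (γ t) (X t) : TangentBundle I M))) :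
    ContMDiff (𝓘(ℝ, ℝ).prod 𝓘(ℝ, ℝ)) I ∞
      (uncurry fun (t : ℝ) (σ : ℝ) ↦ expMap cov (γ t) (σ • X t)) := by
  have hF : ContMDiff (𝓘(ℝ, ℝ).prod 𝓘(ℝ, ℝ)) I.tangent ∞
      (fun q : ℝ × ℝ ↦ (TotalSpace.mk' E (γ q.1) (q.2 • X q.1) : TangentBundle I M)) :=
    contMDiff_liftAlong_smul (c := fun q : ℝ × ℝ ↦ γ q.1) (Z := fun q : ℝ × ℝ ↦ X q.1)
      (hX.comp contMDiff_fst) contMDiff_snd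
  have hexp := contMDiffOn_expMap_totalSpace (cov := cov) (k := (⊤ : ℕ∞)) le_top
  have hmem : ∀ q : ℝ × ℝ, (TotalSpace.mk' E (γ q.1) (q.2 • X q.1) : TangentBundle I M) ∈
      {p : TangentBundle I M | (1 : ℝ) ∈ maximalGeodesicDomain cov p.proj p.2} := fun q ↦ by
    show (1 : ℝ) ∈ maximalGeodesicDomain cov (γ q.1) (q.2 • X q.1)
    rw [(maximalGeodesic_of_isGeodesicallyComplete hc _ _).1]
    exact mem_univ _
  exact hexp.comp_contMDiff hF hmem

omit [CovariantDerivative.ContMDiffCovariantDerivative cov ∞] in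
/-- The `σ`-curves `σ ↦ exp_y(σ u)` of the variation are geodesics defined on `ℝ` (`exp_y(σ u) =
γ_u(σ)`, `expMap_smul`). [cite: LeeRiemannianManifolds2018, Prop. 5.19 (b)] -/
theorem isGeodesic_expMap_smul_of_isGeodesicallyComplete (hc : IsGeodesicallyComplete cov) (y : M)
    (u : TangentSpace I y) : IsGeodesic cov (fun σ : ℝ ↦ expMap cov y (σ • u)) := by
  have hfun : (fun σ : ℝ ↦ expMap cov y (σ • u)) = maximalGeodesic cov y u :=
    funext fun σ ↦ expMap_smul hc y u σ
  rw [hfun]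
  exact (maximalGeodesic_of_isGeodesicallyComplete hc y u).2.1

end Variation

/-! ### Metric quantities along the variation -/

variable (g : PseudoRiemannianMetric I n E (TangentSpace I : M → Type _)) [g.HasLeviCivita]

omit [g.HasLeviCivita] in
/-- **Arc length as a real integral**: if `t ↦ g(c'(t), c'(t))` is continuous and `a ≤ b`, then
`L(c|[a,b]) = ∫_a^b g(c', c')^{1/2} dt` as an extended real (`length_eq_lintegral` and
`ofReal_integral_eq_lintegral_ofReal`). O'Neill 1983, Ch. 5, Def. 11. [cite: ONeill1983, Ch. 5, Def. 11] -/
theorem length_eq_ofReal_integral (hg : g.IsRiemannian) {c : ℝ → M} {a b : ℝ} (hab : a ≤ b)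
    (hcont : Continuous fun t ↦ g.val (c t) (velocity I c t) (velocity I c t)) :
    g.length hg c a b =
      ENNReal.ofReal (∫ t in a..b, Real.sqrt (g.val (c t) (velocity I c t) (velocity I c t))) := by
  rw [g.length_eq_lintegral hg, intervalIntegral.integral_of_le hab, ← integral_Icc_eq_integral_Ioc,
    ofReal_integral_eq_lintegral_ofReal]
  · rfl
  · exact (Real.continuous_sqrt.comp hcont).integrableOn_Icc
  · exact Eventually.of_forall fun t ↦ Real.sqrt_nonneg _

variable [CompleteSpace E]

/-- **The first-variation integrand integrates to boundary terms along a geodesic**: for a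
geodesic `γ` of the Levi-Civita connection of a smooth metric and a `C^∞` field `X` along it,
`∫_a^b g(D_t X, γ') dt = g(X(b), γ'(b)) - g(X(a), γ'(a))` (metric compatibility
`(d/dt) g(X, γ') = g(D_t X, γ') + g(X, D_t γ')` with `D_t γ' = 0`, and the fundamental theorem of
calculus). Lee 2018, proof of Thm. 6.3 / Prop. 6.5 (integration by parts in the first variation
formula). [cite: LeeRiemannianManifolds2018, Thm. 6.3 (proof)] -/
theorem integral_val_covariantDerivAlong_velocity (hn : (∞ : ℕ∞ω) ≤ n) {γ : ℝ → M}
    (hgeo : IsGeodesic g.leviCivita γ) (hγ : ContMDiff 𝓘(ℝ, ℝ) I ∞ γ)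
    {X : Π t : ℝ, TangentSpace I (γ t)}
    (hX : ContMDiff 𝓘(ℝ, ℝ) I.tangent ∞ (fun t ↦ (TotalSpace.mk' E (γ t) (X t) : TangentBundle I M)))
    (a b : ℝ) :
    ∫ t in a..b, g.val (γ t) (covariantDerivAlong g.leviCivita γ X t) (velocity I γ t) =
      g.val (γ b) (X b) (velocity I γ b) - g.val (γ a) (X a) (velocity I γ a) := by
  haveI : Fact (1 ≤ n) := ⟨le_trans (by exact_mod_cast le_top) hn⟩
  have hLC : g.IsLeviCivita g.leviCivita := isLeviCivita_leviCivita_holds (g := g)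
  have hcovI : g.leviCivita.IsLocallyContMDiff ∞ :=
    g.isLocallyContMDiff_leviCivita_holds ⊤ (le_trans (by exact_mod_cast le_rfl) hn)
  have hTl := contMDiff_lift_velocity_of_contMDiff (I := I) hγ
  have hDX := contMDiff_lift_covariantDerivAlong_of_lift hcovI hX
  have hderiv : ∀ t, HasDerivAt (fun t ↦ g.val (γ t) (X t) (velocity I γ t))
      (g.val (γ t) (covariantDerivAlong g.leviCivita γ X t) (velocity I γ t)) t := by
    intro t
    have h := g.hasDerivAt_val_apply_along hLC.2 ((hX t).mdifferentiableAt (by simp))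
      ((hTl t).mdifferentiableAt (by simp))
    rw [hgeo.2 t (mem_univ t), map_zero, add_zero] at h
    exact h
  have hsm : ContMDiff 𝓘(ℝ, ℝ) 𝓘(ℝ, ℝ) ∞
      (fun t ↦ g.val (γ t) (covariantDerivAlong g.leviCivita γ X t) (velocity I γ t)) :=
    fun t ↦ contMDiffAt_val_apply_along g hn (hDX t) (hTl t)
  have hcont : Continuous fun t ↦ g.val (γ t) (covariantDerivAlong g.leviCivita γ X t) (velocity I γ t) :=
    hsm.continuous
  exact intervalIntegral.integral_eq_sub_of_hasDerivAt (fun t _ ↦ hderiv t) (hcont.intervalIntegrable a b)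

variable [T2Space M] [BoundarylessManifold I M]
  [CovariantDerivative.ContMDiffCovariantDerivative g.leviCivita 1]
  [CovariantDerivative.ContMDiffCovariantDerivative g.leviCivita ∞]

/-- **Second-order Taylor bound for the energy of the variation `x(t, σ) = exp_{γ(t)}(σ X(t))`**,
the quantitative form of the second variation formula used here in place of Lee 2018, Thm. 10.22
(for the energy, through geodesics in `σ`, without differentiating under the integral sign).
Let `g` be a smooth Riemannian-or-not metric with complete Levi-Civita connection, `t ↦ (γ t, X t)`
a `C^∞` lift, `a ≤ b`, and write `T = ∂_t x`, `S = ∂_σ x`. Then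
(i) the index integrand `q(t) = g(R(X, γ')X, γ') + g(D_t X, D_t X)` is continuous, and
(ii) for every `ε > 0` there is `δ > 0` with, for all `σ ∈ [0, δ]`,
`∫_a^b g(T,T)(t,σ) dt ≤ ∫_a^b g(γ',γ') + σ ∫_a^b 2 g(D_t X, γ') + σ² (∫_a^b q + ε (b - a))`.
Proof: pointwise `∂_σ g(T,T) = 2 g(D_t S, T)` and `∂_σ g(D_t S, T) = h := g(R(S,T)S,T) + |D_t S|²`
(`ExpMapSecondVariation.lean`); `h` is the `σ`-derivative of the `C^∞` function `g(D_t S, T)` of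
`(t, σ)`, hence continuous, hence uniformly continuous on `[a,b] × [0,1]`; so for `σ ∈ [0, δ]` the
defect `g(T,T)(σ) - g(T,T)(0) - 2σ g(D_tS,T)(0) - σ²(h(0) + ε)` has nonpositive second derivative,
zero first derivative and value at `σ = 0`, hence is `≤ 0` (monotonicity); integrate in `t`, and
identify the quantities at `σ = 0` (`x(t,0) = γ(t)`, `S(t,0) = X(t)`, `T(t,0) = γ'(t)`,
`D_tS(t,0) = D_tX(t)`). [cite: LeeRiemannianManifolds2018, Thm. 10.22 and Thm. 10.26 (proof)] -/
theorem integral_energy_le_taylor (hn : (∞ : ℕ∞ω) ≤ n) (hc : IsGeodesicallyComplete g.leviCivita)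
    {γ : ℝ → M} {X : Π t : ℝ, TangentSpace I (γ t)}
    (hX : ContMDiff 𝓘(ℝ, ℝ) I.tangent ∞ (fun t ↦ (TotalSpace.mk' E (γ t) (X t) : TangentBundle I M)))
    {a b : ℝ} (hab : a ≤ b) :
    Continuous (fun t ↦
        g.val (γ t) (g.leviCivita.curvature (γ t) (X t) (velocity I γ t) (X t)) (velocity I γ t) +
          g.val (γ t) (covariantDerivAlong g.leviCivita γ X t) (covariantDerivAlong g.leviCivita γ X t)) ∧
      ∀ ε > 0, ∃ δ > 0, ∀ σ ∈ Icc (0 : ℝ) δ,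
        ∫ t in a..b, g.val (expMap g.leviCivita (γ t) (σ • X t))
            (velocity I (fun t' ↦ expMap g.leviCivita (γ t') (σ • X t')) t)
            (velocity I (fun t' ↦ expMap g.leviCivita (γ t') (σ • X t')) t) ≤
          (∫ t in a..b, g.val (γ t) (velocity I γ t) (velocity I γ t)) +
            σ * (∫ t in a..b, 2 * g.val (γ t) (covariantDerivAlong g.leviCivita γ X t) (velocity I γ t)) +
            σ * σ * ((∫ t in a..b,
              (g.val (γ t) (g.leviCivita.curvature (γ t) (X t) (velocity I γ t) (X t)) (velocity I γ t) +
                g.val (γ t) (covariantDerivAlong g.leviCivita γ X t)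
                  (covariantDerivAlong g.leviCivita γ X t))) + ε * (b - a)) := by
  haveI : Fact (1 ≤ n) := ⟨le_trans (by exact_mod_cast le_top) hn⟩
  set cov := g.leviCivita with hcov_def
  have hcovI : cov.IsLocallyContMDiff ∞ :=
    g.isLocallyContMDiff_leviCivita_holds ⊤ (le_trans (by exact_mod_cast le_rfl) hn)
  -- the variation and its smoothness
  set x : ℝ → ℝ → M := fun t σ ↦ expMap cov (γ t) (σ • X t) with hx_def
  have hx : ContMDiff (𝓘(ℝ, ℝ).prod 𝓘(ℝ, ℝ)) I ∞ (uncurry x) :=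
    contMDiff_uncurry_expMap_smul_field hc hX
  have hgeo : ∀ t, IsGeodesic cov (x t) := fun t ↦
    isGeodesic_expMap_smul_of_isGeodesicallyComplete hc (γ t) (X t)
  -- lifts of `T = x_t`, `S = x_σ`, `D_t S`
  have hT : ContMDiff (𝓘(ℝ, ℝ).prod 𝓘(ℝ, ℝ)) I.tangent ∞ (fun q : ℝ × ℝ ↦
      (TotalSpace.mk' E (x q.1 q.2) (velocity I (fun t' ↦ x t' q.2) q.1) : TangentBundle I M)) :=
    contMDiff_lift_velocity_uncurry_left hx
  have hswap : ContMDiff (𝓘(ℝ, ℝ).prod 𝓘(ℝ, ℝ)) (𝓘(ℝ, ℝ).prod 𝓘(ℝ, ℝ)) ∞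
      (fun q : ℝ × ℝ ↦ ((q.2, q.1) : ℝ × ℝ)) := contMDiff_snd.prodMk contMDiff_fst
  have hS : ContMDiff (𝓘(ℝ, ℝ).prod 𝓘(ℝ, ℝ)) I.tangent ∞ (fun q : ℝ × ℝ ↦
      (TotalSpace.mk' E (x q.1 q.2) (velocity I (x q.1) q.2) : TangentBundle I M)) := by
    have hx' : ContMDiff (𝓘(ℝ, ℝ).prod 𝓘(ℝ, ℝ)) I ∞ (uncurry fun s t ↦ x t s) := hx.comp hswap
    exact (contMDiff_lift_velocity_uncurry_left hx').comp hswap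
  have hDtS : ContMDiff (𝓘(ℝ, ℝ).prod 𝓘(ℝ, ℝ)) I.tangent ∞ (fun q : ℝ × ℝ ↦
      (TotalSpace.mk' E (x q.1 q.2) (covariantDerivAlong cov (fun t' ↦ x t' q.2)
        (fun t' ↦ velocity I (x t') q.2) q.1) : TangentBundle I M)) :=
    contMDiff_lift_covariantDerivAlong_curry_left (cov := cov) hcovI hx hS
  -- the scalar functions `f = g(T,T)`, `k = g(D_tS, T)`, `h = g(R(S,T)S,T) + |D_tS|²`
  set f : ℝ → ℝ → ℝ := fun t σ ↦ g.val (x t σ) (velocity I (fun t' ↦ x t' σ) t)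
    (velocity I (fun t' ↦ x t' σ) t) with hf_def
  set k : ℝ → ℝ → ℝ := fun t σ ↦ g.val (x t σ) (covariantDerivAlong cov (fun t' ↦ x t' σ)
    (fun t' ↦ velocity I (x t') σ) t) (velocity I (fun t' ↦ x t' σ) t) with hk_def
  set h : ℝ → ℝ → ℝ := fun t σ ↦ g.val (x t σ) (cov.curvature (x t σ) (velocity I (x t) σ)
      (velocity I (fun t' ↦ x t' σ) t) (velocity I (x t) σ)) (velocity I (fun t' ↦ x t' σ) t) +
    g.val (x t σ) (covariantDerivAlong cov (fun t' ↦ x t' σ) (fun t' ↦ velocity I (x t') σ) t)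
      (covariantDerivAlong cov (fun t' ↦ x t' σ) (fun t' ↦ velocity I (x t') σ) t) with hh_def
  have hfS : ContMDiff (𝓘(ℝ, ℝ).prod 𝓘(ℝ, ℝ)) 𝓘(ℝ, ℝ) ∞ (fun q : ℝ × ℝ ↦ f q.1 q.2) :=
    fun q ↦ contMDiffAt_val_apply_along g hn (hT q) (hT q)
  have hkS : ContMDiff (𝓘(ℝ, ℝ).prod 𝓘(ℝ, ℝ)) 𝓘(ℝ, ℝ) ∞ (fun q : ℝ × ℝ ↦ k q.1 q.2) :=
    fun q ↦ contMDiffAt_val_apply_along g hn (hDtS q) (hT q)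
  have hkC : ContDiff ℝ ∞ (fun q : ℝ × ℝ ↦ k q.1 q.2) := by
    have h1 : ContMDiff 𝓘(ℝ, ℝ × ℝ) 𝓘(ℝ, ℝ) ∞ (fun q : ℝ × ℝ ↦ k q.1 q.2) := by
      rw [modelWithCornersSelf_prod, ← chartedSpaceSelf_prod]
      exact hkS
    exact contMDiff_iff_contDiff.1 h1
  -- the `σ`-derivatives
  have hfd : ∀ t σ, HasDerivAt (fun σ' ↦ f t σ') (2 * k t σ) σ := by
    intro t σ
    have h1 := (hasDerivAt_half_val_velocity g hn hx t σ).const_mul (2 : ℝ)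
    refine h1.congr_of_eventuallyEq (Eventually.of_forall fun σ' ↦ ?_)
    show f t σ' = 2 * ((1 / 2 : ℝ) * f t σ')
    ring
  have hkd : ∀ t σ, HasDerivAt (fun σ' ↦ k t σ') (h t σ) σ := fun t σ ↦
    hasDerivAt_val_covariantDerivAlong_velocity g hn hx hgeo t σ
  -- `h` is a partial derivative of the smooth `k`, hence continuous
  have hkf : ∀ t σ, HasDerivAt (fun σ' ↦ k t σ')
      (fderiv ℝ (fun q : ℝ × ℝ ↦ k q.1 q.2) (t, σ) ((0 : ℝ), (1 : ℝ))) σ := by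
    intro t σ
    have hl : HasDerivAt (fun σ' : ℝ ↦ ((t, σ') : ℝ × ℝ)) ((0 : ℝ), (1 : ℝ)) σ :=
      (hasDerivAt_const σ t).prodMk (hasDerivAt_id' σ)
    exact ((hkC.differentiable (by simp) (t, σ)).hasFDerivAt).comp_hasDerivAt σ hl
  have hh_eq : ∀ t σ, h t σ = fderiv ℝ (fun q : ℝ × ℝ ↦ k q.1 q.2) (t, σ) ((0 : ℝ), (1 : ℝ)) :=
    fun t σ ↦ (hkd t σ).unique (hkf t σ)
  have hhc : Continuous (fun q : ℝ × ℝ ↦ h q.1 q.2) := by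
    have h1 : Continuous (fun q : ℝ × ℝ ↦
        fderiv ℝ (fun q : ℝ × ℝ ↦ k q.1 q.2) q ((0 : ℝ), (1 : ℝ))) :=
      (hkC.continuous_fderiv (by simp)).clm_apply continuous_const
    exact h1.congr fun q ↦ (hh_eq q.1 q.2).symm
  -- the quantities at `σ = 0`
  have hx0 : ∀ t, x t 0 = γ t := fun t ↦ by
    show expMap cov (γ t) ((0 : ℝ) • X t) = γ t
    rw [zero_smul]
    exact expMap_zero (cov := cov) (γ t)
  have hfun0 : (fun t ↦ x t 0) = γ := funext hx0
  have hS0 : ∀ t, (velocity I (x t) 0 : E) = (X t : E) := fun t ↦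
    velocity_expMap_smul_zero (γ t) (X t)
  have hT0 : ∀ t, (velocity I (fun t' ↦ x t' 0) t : E) = (velocity I γ t : E) := fun t ↦ by
    rw [hfun0]
  have hlift0 : (fun t ↦ (TotalSpace.mk' E (x t 0) (velocity I (x t) 0) : TangentBundle I M)) =
      fun t ↦ (TotalSpace.mk' E (γ t) (X t) : TangentBundle I M) :=
    funext fun t ↦ TotalSpace.ext (hx0 t) (heq_of_eq (hS0 t))
  have hD0 : ∀ t, (covariantDerivAlong cov (fun t' ↦ x t' 0) (fun t' ↦ velocity I (x t') 0) t : E) =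
      (covariantDerivAlong cov γ X t : E) := fun t ↦
    covariantDerivAlong_congr_of_eventuallyEq cov (Eventually.of_forall fun t' ↦ congrFun hlift0 t')
  have hf0 : ∀ t, f t 0 = g.val (γ t) (velocity I γ t) (velocity I γ t) := fun t ↦ by
    show g.val (x t 0) (velocity I (fun t' ↦ x t' 0) t) (velocity I (fun t' ↦ x t' 0) t) = _
    rw [hT0 t, hx0 t]
  have hk0 : ∀ t, k t 0 = g.val (γ t) (covariantDerivAlong cov γ X t) (velocity I γ t) := fun t ↦ by
    show g.val (x t 0) (covariantDerivAlong cov (fun t' ↦ x t' 0) (fun t' ↦ velocity I (x t') 0) t)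
      (velocity I (fun t' ↦ x t' 0) t) = _
    rw [hD0 t, hT0 t, hx0 t]
  have hh0 : ∀ t, h t 0 =
      g.val (γ t) (cov.curvature (γ t) (X t) (velocity I γ t) (X t)) (velocity I γ t) +
        g.val (γ t) (covariantDerivAlong cov γ X t) (covariantDerivAlong cov γ X t) := fun t ↦ by
    show g.val (x t 0) (cov.curvature (x t 0) (velocity I (x t) 0) (velocity I (fun t' ↦ x t' 0) t)
        (velocity I (x t) 0)) (velocity I (fun t' ↦ x t' 0) t) +
      g.val (x t 0) (covariantDerivAlong cov (fun t' ↦ x t' 0) (fun t' ↦ velocity I (x t') 0) t)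
        (covariantDerivAlong cov (fun t' ↦ x t' 0) (fun t' ↦ velocity I (x t') 0) t) = _
    rw [hD0 t, hT0 t, hS0 t, hx0 t]
  -- continuity in `t`
  have hcf : ∀ σ', Continuous (fun t ↦ f t σ') := fun σ' ↦
    hfS.continuous.comp (continuous_id.prodMk continuous_const)
  have hck : Continuous (fun t ↦ k t 0) := hkS.continuous.comp (continuous_id.prodMk continuous_const)
  have hch : Continuous (fun t ↦ h t 0) := hhc.comp (continuous_id.prodMk continuous_const)
  refine ⟨hch.congr fun t ↦ hh0 t, ?_⟩
  intro ε hε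
  -- uniform continuity of `h` on `[a, b] × [0, 1]`
  obtain ⟨δ, hδ, hU⟩ := Metric.uniformContinuousOn_iff.1
    ((isCompact_Icc.prod isCompact_Icc : IsCompact (Icc a b ×ˢ Icc (0 : ℝ) 1)).uniformContinuousOn_of_continuous
      hhc.continuousOn) ε hε
  set δ₀ : ℝ := min (δ / 2) 1 with hδ₀_def
  have hδ₀ : 0 < δ₀ := lt_min (by linarith) one_pos
  have hδ₀δ : δ₀ < δ := lt_of_le_of_lt (min_le_left _ _) (by linarith)
  have hδ₀1 : δ₀ ≤ 1 := min_le_right _ _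
  refine ⟨δ₀, hδ₀, fun σ hσ ↦ ?_⟩
  have hclose : ∀ t ∈ Icc a b, ∀ ξ ∈ Icc (0 : ℝ) δ₀, h t ξ ≤ h t 0 + ε := by
    intro t ht ξ hξ
    have hξ1 : ξ ∈ Icc (0 : ℝ) 1 := ⟨hξ.1, hξ.2.trans hδ₀1⟩
    have h0mem : (0 : ℝ) ∈ Icc (0 : ℝ) 1 := ⟨le_rfl, zero_le_one⟩
    have hdist : dist ((t, ξ) : ℝ × ℝ) (t, 0) < δ := by
      rw [Prod.dist_eq, dist_self, Real.dist_eq, sub_zero, abs_of_nonneg hξ.1, max_eq_right hξ.1]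
      exact lt_of_le_of_lt hξ.2 hδ₀δ
    have h1 := hU (t, ξ) ⟨ht, hξ1⟩ (t, 0) ⟨ht, h0mem⟩ hdist
    rw [Real.dist_eq] at h1
    linarith [(abs_sub_lt_iff.1 h1).1]
  -- pointwise second-order Taylor bound
  have hpt : ∀ t ∈ Icc a b, f t σ ≤ f t 0 + σ * (2 * k t 0) + σ * σ * (h t 0 + ε) := by
    intro t ht
    -- the first derivative of the defect is nonpositive
    have hψd : ∀ ξ, HasDerivAt (fun ξ ↦ 2 * k t ξ - ξ * (2 * (h t 0 + ε)) - 2 * k t 0)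
        (2 * h t ξ - 2 * (h t 0 + ε)) ξ := fun ξ ↦
      (((hkd t ξ).const_mul 2).sub (hasDerivAt_mul_const _)).sub_const _
    have hψanti : AntitoneOn (fun ξ ↦ 2 * k t ξ - ξ * (2 * (h t 0 + ε)) - 2 * k t 0) (Icc 0 δ₀) := by
      refine antitoneOn_of_deriv_nonpos (convex_Icc 0 δ₀)
        (HasDerivAt.continuousOn fun ξ _ ↦ hψd ξ)
        (fun ξ _ ↦ (hψd ξ).differentiableAt.differentiableWithinAt) ?_
      intro ξ hξ
      rw [interior_Icc] at hξ
      rw [(hψd ξ).deriv]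
      have := hclose t ht ξ ⟨hξ.1.le, hξ.2.le⟩
      linarith
    have hψle : ∀ ξ ∈ Icc (0 : ℝ) δ₀, 2 * k t ξ - ξ * (2 * (h t 0 + ε)) - 2 * k t 0 ≤ 0 := by
      intro ξ hξ
      have h0 := hψanti ⟨le_rfl, hδ₀.le⟩ hξ hξ.1
      have h00 : (2 * k t 0 - 0 * (2 * (h t 0 + ε)) - 2 * k t 0 : ℝ) = 0 := by ring
      linarith
    -- hence the defect is nonincreasing on `[0, δ₀]` and vanishes at `0`
    have hφd : ∀ ξ, HasDerivAt (fun ξ ↦ f t ξ - ξ * (2 * k t 0) - ξ * ξ * (h t 0 + ε) - f t 0)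
        (2 * k t ξ - 2 * k t 0 - (1 * ξ + ξ * 1) * (h t 0 + ε)) ξ := fun ξ ↦
      (((hfd t ξ).sub (hasDerivAt_mul_const _)).sub
        (((hasDerivAt_id' ξ).mul (hasDerivAt_id' ξ)).mul_const _)).sub_const _
    have hφanti : AntitoneOn (fun ξ ↦ f t ξ - ξ * (2 * k t 0) - ξ * ξ * (h t 0 + ε) - f t 0)
        (Icc 0 δ₀) := by
      refine antitoneOn_of_deriv_nonpos (convex_Icc 0 δ₀)
        (HasDerivAt.continuousOn fun ξ _ ↦ hφd ξ)
        (fun ξ _ ↦ (hφd ξ).differentiableAt.differentiableWithinAt) ?_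
      intro ξ hξ
      rw [interior_Icc] at hξ
      rw [(hφd ξ).deriv]
      have h1 := hψle ξ ⟨hξ.1.le, hξ.2.le⟩
      have h2 : (1 * ξ + ξ * 1) * (h t 0 + ε) = ξ * (2 * (h t 0 + ε)) := by ring
      linarith
    have h1 := hφanti ⟨le_rfl, hδ₀.le⟩ hσ hσ.1
    have h00 : (f t 0 - 0 * (2 * k t 0) - 0 * 0 * (h t 0 + ε) - f t 0 : ℝ) = 0 := by ring
    linarith
  -- integrate over `[a, b]`
  have hIfσ : IntervalIntegrable (fun t ↦ f t σ) volume a b := (hcf σ).intervalIntegrable a b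
  have hIf0 : IntervalIntegrable (fun t ↦ f t 0) volume a b := (hcf 0).intervalIntegrable a b
  have hIk : IntervalIntegrable (fun t ↦ 2 * k t 0) volume a b :=
    (continuous_const.mul hck).intervalIntegrable a b
  have hIk' : IntervalIntegrable (fun t ↦ σ * (2 * k t 0)) volume a b :=
    (continuous_const.mul (continuous_const.mul hck)).intervalIntegrable a b
  have hIh : IntervalIntegrable (fun t ↦ h t 0) volume a b := hch.intervalIntegrable a b
  have hIhe : IntervalIntegrable (fun t ↦ h t 0 + ε) volume a b :=
    (hch.add continuous_const).intervalIntegrable a b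
  have hIhe' : IntervalIntegrable (fun t ↦ σ * σ * (h t 0 + ε)) volume a b :=
    (continuous_const.mul (hch.add continuous_const)).intervalIntegrable a b
  have hIsum : IntervalIntegrable (fun t ↦ f t 0 + σ * (2 * k t 0)) volume a b := hIf0.add hIk'
  have hmono : ∫ t in a..b, f t σ ≤ ∫ t in a..b, (f t 0 + σ * (2 * k t 0) + σ * σ * (h t 0 + ε)) :=
    intervalIntegral.integral_mono_on hab hIfσ (hIsum.add hIhe') hpt
  have hsplit : ∫ t in a..b, (f t 0 + σ * (2 * k t 0) + σ * σ * (h t 0 + ε)) =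
      (∫ t in a..b, f t 0) + σ * (∫ t in a..b, 2 * k t 0) +
        σ * σ * ((∫ t in a..b, h t 0) + ε * (b - a)) := by
    have e1 : ∫ t in a..b, (f t 0 + σ * (2 * k t 0) + σ * σ * (h t 0 + ε)) =
        (∫ t in a..b, (f t 0 + σ * (2 * k t 0))) + ∫ t in a..b, σ * σ * (h t 0 + ε) :=
      intervalIntegral.integral_add hIsum hIhe'
    have e2 : ∫ t in a..b, (f t 0 + σ * (2 * k t 0)) =
        (∫ t in a..b, f t 0) + ∫ t in a..b, σ * (2 * k t 0) :=
      intervalIntegral.integral_add hIf0 hIk'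
    have e3 : ∫ t in a..b, σ * (2 * k t 0) = σ * ∫ t in a..b, 2 * k t 0 :=
      intervalIntegral.integral_const_mul σ (fun t ↦ 2 * k t 0)
    have e4 : ∫ t in a..b, σ * σ * (h t 0 + ε) = σ * σ * ∫ t in a..b, (h t 0 + ε) :=
      intervalIntegral.integral_const_mul (σ * σ) (fun t ↦ h t 0 + ε)
    have e5 : ∫ t in a..b, (h t 0 + ε) = (∫ t in a..b, h t 0) + ∫ _ in a..b, ε :=
      intervalIntegral.integral_add hIh (continuous_const.intervalIntegrable a b)
    have e6 : ∫ _ in a..b, ε = (b - a) * ε := by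
      rw [intervalIntegral.integral_const, smul_eq_mul]
    rw [e1, e2, e3, e4, e5, e6]
    ring
  have hef : (fun t ↦ f t 0) = fun t ↦ g.val (γ t) (velocity I γ t) (velocity I γ t) := funext hf0
  have hek : (fun t ↦ 2 * k t 0) = fun t ↦
      2 * g.val (γ t) (covariantDerivAlong cov γ X t) (velocity I γ t) :=
    funext fun t ↦ by rw [hk0 t]
  have heh : (fun t ↦ h t 0) = fun t ↦
      g.val (γ t) (cov.curvature (γ t) (X t) (velocity I γ t) (X t)) (velocity I γ t) +
        g.val (γ t) (covariantDerivAlong cov γ X t) (covariantDerivAlong cov γ X t) := funext hh0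
  have hfin := hmono.trans_eq hsplit
  rw [hef, hek, heh] at hfin
  exact hfin

end Literature.Geometry.Riemannian

end
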